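import Literature.NumberTheory.LFunctions.JensenHyperbolicityCertifiedRanges
import Literature.NumberTheory.LFunctions.RiemannHypothesisUpTo10000EM
import Literature.NumberTheory.LFunctions.RiemannHypothesisUpTo100000
import Literature.NumberTheory.LFunctions.RiemannHypothesisUpTo1000
import Literature.NumberTheory.LFunctions.RiemannHypothesisUpTo100000X
import Literature.NumberTheory.LFunctions.RiemannHypothesisUpTo1000X
import HarnessLib

/-!
# All-shift hyperbolicity of the Jensen polynomials of `ξ`: `d ≤ 10⁸` and `d ≤ 10¹⁰` (compiled,
# unconditional), `d ≤ 10⁶` (kernel, unconditional)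

Topic `Literature/NumberTheory/LFunctions`. The printed reduction "`RH(T)` and `d ≤ T²` ⇒ `J^{d,n}_γ`
hyperbolic for every shift `n`" (Griffin–Ono–Rolen–Thorner–Tripp–Wagner 2022, Thm. 1.2; Kim–Lee 2022,
Thm. 4 — the tree's `jensenPoly_xiTaylorCoeff_splits_allShifts_of_riemannHypothesisUpTo`,
`JensenHyperbolicityCertifiedRanges.lean`) applied to the two new certified heights of the tree:

* `T = 10⁴`, `riemannHypothesisUpTo_10000` (`RiemannHypothesisUpTo10000EM.lean`: Euler–Maclaurin sign
  certificate of the 10 142 zeros up to `10⁴` + Turing's method; compiled evaluation, NO named fact)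
  ⇒ `J^{d,n}_γ` hyperbolic for every `n` and every `d ≤ 10⁸`
  (`jensenPoly_xiTaylorCoeff_splits_allShifts_of_le_1e8`) — the tree's compiled all-shift range grows
  from `d ≤ 6 330 256` (`T = 2516`) to `d ≤ 10⁸`;
* `T = 10⁵`, `RHT100000.riemannHypothesisUpTo_100000` (`RiemannHypothesisUpTo100000.lean`:
  Riemann–Siegel sign certificate of the 138 069 zeros up to `10⁵`, conditional on the named fact
  `Literature.NumberTheory.LFunctions.Gabcke.satz322b_R0` = Gabcke 1979 Satz 3.2.2 (b)) ⇒ every `n`,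
  every `d ≤ 10¹⁰` (`jensenPoly_xiTaylorCoeff_splits_allShifts_of_le_1e10`, conditional on that fact).

* `T = 10³`, `RHT1000.riemannHypothesisUpTo_1000` (`RiemannHypothesisUpTo1000.lean`: the same certificate
  format checked by the KERNEL, `decide +kernel`, standard axioms only; conditional on
  `Gabcke.satz322b_R0`) ⇒ every `n`, every `d ≤ 10⁶`
  (`jensenPoly_xiTaylorCoeff_splits_allShifts_of_le_1e6`) — the kernel-grade all-shift range grows
  from `d ≤ 10 201` (unconditional) to `d ≤ 10⁶` (conditional on that one printed fact).

* UNCONDITIONAL upgrades (appended): with the Riemann–Siegel remainder bound PROVED in the tree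
  (`Gabcke.abs_R0_le_explicit_of_ge`, `RiemannSiegelRemainderK0.lean`) and the certificates re-verified
  with it (`riemannHypothesisUpTo_100000`, `RiemannHypothesisUpTo100000X.lean`, compiled;
  `riemannHypothesisUpTo_1000`, `RiemannHypothesisUpTo1000X.lean`, kernel), the ranges `d ≤ 10¹⁰`
  (compiled) and `d ≤ 10⁶` (kernel) hold with NO named fact
  (`jensenPoly_xiTaylorCoeff_splits_allShifts_of_le_1e10'`, `…_upTo_1e10`, `…_of_le_1e6'`).

The printed `d ≤ 9·10²⁴` (Platt–Trudgian's height) stays conditional on the named hypothesis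
`riemannHypothesisUpTo_platt_trudgian` (`jensenPoly_xiTaylorCoeff_splits_allShifts_of_platt_trudgian`).
Nothing about zeros follows from such ranges (barrier
`Literature.Barriers.RiemannHypothesis.JensenPolynomialsShiftUniform_holds`).

## References

* [GriffinEtAl2022] M. Griffin, K. Ono, L. Rolen, J. Thorner, Z. Tripp, I. Wagner, Adv. Math. 397
  (2022) 108186, Thm. 1.2.
* [KimLee2021] Y.-O. Kim, J. Lee, J. Korean Math. Soc. 59 (2022), Thm. 4 and Remark.
* [Gabcke1979] W. Gabcke, Dissertation Göttingen 1979, Satz 3.2.2.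
* [Brent1979] R. P. Brent, Math. Comp. 33 (1979), §4.
-/

noncomputable section

open Polynomial

namespace Literature.NumberTheory.LFunctions

open Literature.NumberTheory.DiophantineGeometry

/-- **`J^{d,n}_γ` is hyperbolic for every shift `n` and every degree `d ≤ 10⁸`** (compiled evaluation,
no named fact): GORTTW's / Kim–Lee's reduction at the tree's certified height `T = 10⁴`
(`riemannHypothesisUpTo_10000`); `10⁸ = (10⁴)²`.
[cite: KimLee2021, Theorem 4 and Remark] [cite: GriffinEtAl2022, Theorem 1.2] [cite: Brent1979, §4] -/
theorem jensenPoly_xiTaylorCoeff_splits_allShifts_of_le_1e8 {d : ℕ} (hd : d ≤ 100000000) (n : ℕ) :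
    (jensenPoly xiTaylorCoeff d n).Splits :=
  jensenPoly_xiTaylorCoeff_splits_allShifts_of_riemannHypothesisUpTo (T := 10000) (by norm_num)
    riemannHypothesisUpTo_10000 (by norm_num; exact_mod_cast hd) n

/-- GORZ's wording: for all `1 ≤ d ≤ 10⁸` and all `n ≥ 0`, `J^{d,n}_γ` is hyperbolic (compiled
evaluation; extends `jensenPoly_xiTaylorCoeff_splits_allShifts_upTo_1582564`).
[cite: KimLee2021, Theorem 4 and Remark] -/
theorem jensenPoly_xiTaylorCoeff_splits_allShifts_upTo_1e8 :
    ∀ d n : ℕ, d ≤ 100000000 → (jensenPoly xiTaylorCoeff d n).Splits :=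
  fun _ n hd => jensenPoly_xiTaylorCoeff_splits_allShifts_of_le_1e8 hd n

/-- **`J^{d,n}_γ` is hyperbolic for every shift `n` and every degree `d ≤ 10¹⁰`, conditionally on
Gabcke's Riemann–Siegel remainder bound** (`Gabcke.satz322b_R0`): the same reduction at the certified
height `T = 10⁵` (`RHT100000.riemannHypothesisUpTo_100000`); `10¹⁰ = (10⁵)²`.
[cite: KimLee2021, Theorem 4 and Remark] [cite: GriffinEtAl2022, Theorem 1.2]
[cite: Gabcke1979, Satz 3.2.2 (b) p. 55] -/
theorem jensenPoly_xiTaylorCoeff_splits_allShifts_of_le_1e10 (hG : Gabcke.satz322b_R0) {d : ℕ}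
    (hd : d ≤ 10000000000) (n : ℕ) : (jensenPoly xiTaylorCoeff d n).Splits :=
  jensenPoly_xiTaylorCoeff_splits_allShifts_of_riemannHypothesisUpTo (T := 100000) (by norm_num)
    (RHT100000.riemannHypothesisUpTo_100000 hG) (by norm_num; exact_mod_cast hd) n

/-- **`J^{d,n}_γ` is hyperbolic for every shift `n` and every degree `d ≤ 10⁶`, kernel-checked,
conditionally on Gabcke's Riemann–Siegel remainder bound** (`Gabcke.satz322b_R0`): the reduction at the
kernel-certified height `T = 10³` (`RHT1000.riemannHypothesisUpTo_1000`, standard axioms only);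
`10⁶ = (10³)²`. [cite: KimLee2021, Theorem 4 and Remark] [cite: GriffinEtAl2022, Theorem 1.2]
[cite: Gabcke1979, Satz 3.2.2 (b) p. 55] -/
theorem jensenPoly_xiTaylorCoeff_splits_allShifts_of_le_1e6 (hG : Gabcke.satz322b_R0) {d : ℕ}
    (hd : d ≤ 1000000) (n : ℕ) : (jensenPoly xiTaylorCoeff d n).Splits :=
  jensenPoly_xiTaylorCoeff_splits_allShifts_of_riemannHypothesisUpTo (T := 1000) (by norm_num)
    (RHT1000.riemannHypothesisUpTo_1000 hG) (by norm_num; exact_mod_cast hd) n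

/-- **`J^{d,n}_γ` is hyperbolic for every shift `n` and every degree `d ≤ 10¹⁰` — UNCONDITIONALLY**
(compiled evaluation, no named fact): the reduction at the tree's certified height `T = 10⁵`, now proved
without Gabcke's named bound (`riemannHypothesisUpTo_100000`, `RiemannHypothesisUpTo100000X.lean`: the
Riemann–Siegel sign certificate re-verified with the PROVED remainder `Gabcke.abs_R0_le_explicit_of_ge`);
`10¹⁰ = (10⁵)²`. Supersedes the conditional `jensenPoly_xiTaylorCoeff_splits_allShifts_of_le_1e10`.
[cite: KimLee2021, Theorem 4 and Remark] [cite: GriffinEtAl2022, Theorem 1.2] [cite: Brent1979, §4] -/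
theorem jensenPoly_xiTaylorCoeff_splits_allShifts_of_le_1e10' {d : ℕ} (hd : d ≤ 10000000000) (n : ℕ) :
    (jensenPoly xiTaylorCoeff d n).Splits :=
  jensenPoly_xiTaylorCoeff_splits_allShifts_of_riemannHypothesisUpTo (T := 100000) (by norm_num)
    riemannHypothesisUpTo_100000 (by norm_num; exact_mod_cast hd) n

/-- GORZ's wording: for all `1 ≤ d ≤ 10¹⁰` and all `n ≥ 0`, `J^{d,n}_γ` is hyperbolic (compiled evaluation,
unconditional; extends `jensenPoly_xiTaylorCoeff_splits_allShifts_upTo_1e8`).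
[cite: KimLee2021, Theorem 4 and Remark] -/
theorem jensenPoly_xiTaylorCoeff_splits_allShifts_upTo_1e10 :
    ∀ d n : ℕ, d ≤ 10000000000 → (jensenPoly xiTaylorCoeff d n).Splits :=
  fun _ n hd => jensenPoly_xiTaylorCoeff_splits_allShifts_of_le_1e10' hd n

/-- **`J^{d,n}_γ` is hyperbolic for every shift `n` and every degree `d ≤ 10⁶`, kernel-checked and
UNCONDITIONAL** (standard axioms only): the reduction at the kernel-certified height `T = 10³`, now proved
without Gabcke's named bound (`riemannHypothesisUpTo_1000`, `RiemannHypothesisUpTo1000X.lean`);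
`10⁶ = (10³)²`. Extends the kernel-grade all-shift range from `d ≤ 10 201` to `d ≤ 10⁶`; supersedes the
conditional `jensenPoly_xiTaylorCoeff_splits_allShifts_of_le_1e6`.
[cite: KimLee2021, Theorem 4 and Remark] [cite: GriffinEtAl2022, Theorem 1.2] [cite: Brent1979, §4] -/
theorem jensenPoly_xiTaylorCoeff_splits_allShifts_of_le_1e6' {d : ℕ} (hd : d ≤ 1000000) (n : ℕ) :
    (jensenPoly xiTaylorCoeff d n).Splits :=
  jensenPoly_xiTaylorCoeff_splits_allShifts_of_riemannHypothesisUpTo (T := 1000) (by norm_num)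
    riemannHypothesisUpTo_1000 (by norm_num; exact_mod_cast hd) n

end Literature.NumberTheory.LFunctions

end
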